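import Literature.AlgebraicGeometry.Resolution.ProjectiveModelsCharts
import Literature.AlgebraicGeometry.Resolution.ResolvingSystems
import Literature.AlgebraicGeometry.Resolution.AlterationsDimension
import Literature.AlgebraicGeometry.Resolution.FieldsJ2
import Mathlib.RingTheory.EssentialFiniteness
import HarnessLib

/-!
# Zariski's patching programme: reduction of `CossartPiltant2019Patching` to the patching of
# two projective models

Topic: `Literature/AlgebraicGeometry/Resolution`. The named fact `CossartPiltant2019Patching`
(`ArithmeticalThreefolds.lean`; Cossart–Piltant 2019, Prop. 4.6 [arXiv v1: Prop. 4.4],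
specialised to schemes of finite type over a field: surface resolution + local uniformization in
dimension three ⇒ weak resolution in dimension `≤ 3`) is proved there by "an enhanced version of
Zariski's Patching Theorem [Z5] Fundamental theorem on p.539". This file PROVES the whole
reduction of that fact to the one genuinely three-dimensional published statement it rests on,
the **patching of two projective models** (Zariski 1944, Fundamental Theorem, p. 539, for a pair;
Piltant 2013, Prop. 5.1 with `P = P_reg`: "Let `X₁/k` and `X₂/k` be two projective models of `K`.
There exists a normal and projective model `Y/k` of `K`, together with morphisms `πᵢ : Y → Xᵢ`,
such that `πᵢ⁻¹(Reg_P(Xᵢ)) ⊆ Reg_P(Y)` for `i = 1, 2`"; Cossart–Piltant 2019, proof of Prop. 4.6,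
Step 3, display: "there exists `𝒴 → Spec A` projective birational and morphisms
`πᵢ : 𝒴 → 𝒳ᵢ`, `i = 1, 2`, such that `π₁⁻¹(Reg 𝒳₁) ∪ π₂⁻¹(Reg 𝒳₂) ⊆ Reg 𝒴`"), which is taken
as an explicit HYPOTHESIS written out in full (no named fact is introduced):

* `CossartPiltant2019Patching.of_twoModelPatching` — MAIN: if for every field `k`, every
  function field `K/k` of transcendence degree `3` and every two projective models `M₁`, `M₂`
  of `K/k` (`ProjModel`, `ProjectiveModels.lean`) there is a projective model `N` with
  morphisms of models `N → Mᵢ` under which the preimage of `Reg Mᵢ` is regular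
  (`ProjModel.Hom.RegLe`), then `CossartPiltant2019Patching`.

The proof is Zariski's (Zariski–Samuel II, Ch. VI §17; Piltant 2013, Cor. 5.7; Cossart–Piltant
2019, proof of Prop. 4.6, Steps 1 and 3), assembled from proved results of the tree:

1. reduction to an integral closed subscheme `X ⊆ ℙⁿ_k` of dimension `3`
   (`ResolutionOverUpToDim.of_projective`: components, Chow's lemma, projective closure; the
   dimension-`≤ 2` pieces are resolved by the hypothesis `ResolutionOverUpToDim k 2`);
2. `X` is a projective model of its function field `K = Frac Γ(U)`, `U` an affine chart
   (`ProjModel.ofChart`), and `trdeg_k K = dim X = 3` (`exists_ringKrullDim_eq_and_trdeg_eq`,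
   Matsumura Thm. 5.6);
3. every valuation ring `𝒪_v` of `K/k` contains a finitely generated affine model of `K`
   (`exists_fg_le_valuationSubring`: invert the generators outside `𝒪_v`), of dimension `≤ 3`,
   so `LocalUniformization3 k` uniformizes `v` on a finitely generated `T ⊆ 𝒪_v` with
   `Frac T = K` (`LocalUniformization3.exists_hasRegularCentre`);
4. Zariski's compactness/finiteness theorem (`ZariskiRiemannSpace.compactSpace`, regular loci
   open since fields are J-2, `isJ2Ring_of_field`) yields finitely many such `T`
   (`exists_finite_resolvingSystem'`), and the projective closure of each `Spec T` is a
   projective model on which the corresponding valuations have regular centres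
   (`ProjModel.exists_regCentre_of_hasRegularCentre`) — a finite RESOLVING SYSTEM of
   projective models;
5. patching the models two at a time (the hypothesis; `ProjModel.exists_dominating_regCentre`,
   induction as in Piltant 2013, Cor. 5.7: "By applying `n − 1` consecutive times proposition
   5.1") gives one projective model `N → X` on which EVERY valuation has a regular centre;
6. every point of `N` is a centre, so `N` is regular (`ProjModel.isRegular_of_forall_regCentre`),
   and `N → X` is proper birational (`ProjModel.Hom.hasResolution`): `X` has a resolution.

What is NOT here: the two-model patching itself (Zariski's fundamental loci / elimination of
indeterminacies / principalization on regular threefolds: Piltant 2013 §5, Cossart–Piltant 2019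
Lemma 4.5 and Prop. 4.4 = `CossartPiltant2019Principalization`), which is the remaining content
of `CossartPiltant2019Patching`.

## References

* O. Zariski, *Reduction of the singularities of algebraic three dimensional varieties*, Ann.
  of Math. 45 (1944) 472–542, Fundamental Theorem p. 539.
* O. Zariski, P. Samuel, *Commutative Algebra* II, Ch. VI §17. [ZariskiSamuel1960]
* O. Piltant, *An axiomatic version of Zariski's patching theorem*, RACSAM 107 (2013) 91–121,
  Prop. 5.1, Cor. 5.7.
* V. Cossart, O. Piltant, J. Algebra 529 (2019), Prop. 4.6 and its proof, Steps 1–3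
  (arXiv:1412.0868v1: Prop. 4.4). [CossartPiltant2019]
* H. Matsumura, *Commutative Ring Theory*, Thm. 5.6. [Matsumura1987]
-/

noncomputable section

open CategoryTheory AlgebraicGeometry TopologicalSpace IsLocalRing

namespace Literature.AlgebraicGeometry.Resolution

universe u

/-! ## Every function field has projective models -/

section Nonempty

variable {k K : Type u} [Field k] [Field K] [Algebra k K]

/-- **Every finitely generated field extension has a projective model**: for a finitely
generated `k`-subalgebra `A ⊆ K` with `Frac A = K`, the projective closure of `Spec A` is a
projective model of `K/k` (`ProjModel.exists_regCentre_of_hasRegularCentre`); in particular the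
structure `ProjModel k K` is inhabited for every function field. [folklore] -/
theorem ProjModel.nonempty_of_fg (A : Subalgebra k K) (hA : A.FG) [IsFractionRing A K] :
    Nonempty (ProjModel k K) := by
  obtain ⟨M, -⟩ := ProjModel.exists_regCentre_of_hasRegularCentre A hA
  exact ⟨M⟩

end Nonempty

/-! ## Patching a finite resolving system -/

namespace ProjModel

variable {k K : Type u} [Field k] [Field K] [Algebra k K]

/-- **Patching a finite resolving system** (Zariski 1944, Fundamental Theorem p. 539; Piltant
2013, Cor. 5.7: "By applying `n − 1` consecutive times proposition 5.1, we construct a normal and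
projective model `Y` of `K` such that `Y = Reg_P(Y)` and `Y → X` is a morphism"): if any two
projective models of `K/k` can be dominated by one on which the preimages of their regular loci
are regular, then for every projective model `M₀` and every finite list of projective models
there is a projective model `N → M₀` on which every valuation having a regular centre on `M₀`
or on some member of the list has a regular centre.
[cite: CossartPiltant2019, Prop. 4.6 (arXiv v1: Prop. 4.4), proof, Step 3] -/
theorem exists_dominating_regCentre
    (hZ : ∀ M₁ M₂ : ProjModel k K,
      ∃ (N : ProjModel k K) (φ₁ : N.Hom M₁) (φ₂ : N.Hom M₂), φ₁.RegLe ∧ φ₂.RegLe)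
    (M₀ : ProjModel k K) :
    ∀ l : List (ProjModel k K), ∃ (N : ProjModel k K) (_ : N.Hom M₀),
      ∀ v : ZariskiRiemannSpace k K,
        (M₀.RegCentre v ∨ ∃ M ∈ l, M.RegCentre v) → N.RegCentre v
  | [] => ⟨M₀, ⟨𝟙 M₀.X, Category.id_comp _, Category.comp_id _⟩,
      fun v h => h.elim id fun ⟨_, hM, _⟩ => by simp at hM⟩
  | M :: l => by
    obtain ⟨N, φ, hN⟩ := exists_dominating_regCentre hZ M₀ l
    obtain ⟨N', φ₁, φ₂, h₁, h₂⟩ := hZ N M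
    refine ⟨N', φ₁.comp φ, fun v hv => ?_⟩
    rcases hv with h0 | ⟨M', hM', hreg⟩
    · exact RegCentre.of_hom φ₁ h₁ (hN v (Or.inl h0))
    · rcases List.mem_cons.mp hM' with rfl | hl
      · exact RegCentre.of_hom φ₂ h₂ hreg
      · exact RegCentre.of_hom φ₁ h₁ (hN v (Or.inr ⟨M', hl, hreg⟩))

/-- **Zariski's patching programme for one projective model**: under the two-model patching
hypothesis, if every valuation ring of `K/k` has a regular centre on SOME projective model of a
finite family (a finite resolving system of projective models), then every projective model
`M₀` of `K/k` is dominated by a REGULAR projective model, hence has a resolution of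
singularities (`ProjModel.Hom.hasResolution`). (Zariski–Samuel II, Ch. VI §17; Piltant 2013,
Cor. 5.7; Cossart–Piltant 2019, proof of Prop. 4.6, Step 3.)
[cite: CossartPiltant2019, Prop. 4.6 (arXiv v1: Prop. 4.4), proof, Step 3] -/
theorem hasResolution_of_resolvingSystem
    (hZ : ∀ M₁ M₂ : ProjModel k K,
      ∃ (N : ProjModel k K) (φ₁ : N.Hom M₁) (φ₂ : N.Hom M₂), φ₁.RegLe ∧ φ₂.RegLe)
    (M₀ : ProjModel k K) (l : List (ProjModel k K))
    (hcov : ∀ v : ZariskiRiemannSpace k K, ∃ M ∈ l, M.RegCentre v) :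
    Scheme.HasResolution M₀.X := by
  obtain ⟨N, φ, hN⟩ := exists_dominating_regCentre hZ M₀ l
  exact φ.hasResolution (isRegular_of_forall_regCentre fun v => hN v (Or.inr (hcov v)))

end ProjModel

/-! ## The main theorem -/

/-- **The resolution of an integral projective threefold from local uniformization and the
patching of two projective models** (Zariski 1944; Cossart–Piltant 2019, proof of Prop. 4.6,
Steps 1 and 3; Piltant 2013, Cor. 5.7): for an integral closed subscheme `X ⊆ ℙⁿ_k` of
dimension `3`, `LocalUniformization3 k` and the two-model patching statement for function
fields of transcendence degree `3` over `k` give `Scheme.HasResolution X`.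
[cite: CossartPiltant2019, Prop. 4.6 (arXiv v1: Prop. 4.4), proof, Steps 1–3] -/
theorem hasResolution_of_twoModelPatching_of_dim_three {k : Type u} [Field k]
    (hZ : ∀ (K : Type u) [Field K] [Algebra k K] [Algebra.EssFiniteType k K],
      Algebra.trdeg k K = 3 → ∀ M₁ M₂ : ProjModel k K,
        ∃ (N : ProjModel k K) (φ₁ : N.Hom M₁) (φ₂ : N.Hom M₂), φ₁.RegLe ∧ φ₂.RegLe)
    (hLU : LocalUniformization3 k) {n : ℕ} (X : Scheme.{u}) [IsIntegral X]
    (ι : X ⟶ (Motives.projectiveSpace n k).left) [IsClosedImmersion ι]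
    (hdim : topologicalKrullDim X = 3) : Scheme.HasResolution X := by
  classical
  haveI : IsProper (Motives.projectiveSpace n k).hom := Motives.isProper_projectiveSpace n k
  let πX : X ⟶ Spec (.of k) := ι ≫ (Motives.projectiveSpace n k).hom
  have hproj : Motives.IsProjectiveOver (Over.mk πX) := ⟨n, Over.homMk ι rfl, ‹_›⟩
  haveI : LocallyOfFiniteType πX := inferInstance
  -- an affine chart `U = Spec A` of `X`
  obtain ⟨_, ⟨U', hU', rfl⟩, hηU, -⟩ := X.isBasis_affineOpens.exists_subset_of_mem_open
    (Set.mem_univ (genericPoint X)) isOpen_univ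
  let U : X.Opens := U'
  have hU : IsAffineOpen U := hU'
  haveI : IsAffine U := hU
  haveI : Nonempty U := ⟨⟨_, hηU⟩⟩
  let A : Type u := Γ(U, ⊤)
  -- `A` is a finitely generated `k`-algebra
  let g : (U : Scheme.{u}) ⟶ Spec (.of k) := U.ι ≫ πX
  let ψ : k →+* A := g.appTop.hom.comp (Scheme.ΓSpecIso (.of k)).inv.hom
  have hψ : ψ.FiniteType := by
    have h1 : g.appTop.hom.FiniteType :=
      (HasRingHomProperty.iff_of_isAffine (P := @LocallyOfFiniteType)).mp inferInstance
    exact h1.comp (RingHom.FiniteType.of_surjective _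
      (Scheme.ΓSpecIso (.of k)).symm.commRingCatIsoToRingEquiv.surjective)
  letI : Algebra k A := ψ.toAlgebra
  haveI hft : Algebra.FiniteType k A := hψ
  -- its fraction field `K`, and `X` as a projective model of `K/k`
  let K : Type u := FractionRing A
  let j : Spec (.of A) ⟶ X := U.toScheme.isoSpec.inv ≫ U.ι
  have hj : j ≫ πX = Spec.map (CommRingCat.ofHom (algebraMap k A)) := by
    change (U.toScheme.isoSpec.inv ≫ U.ι) ≫ πX = Spec.map (CommRingCat.ofHom ψ)
    rw [Category.assoc, isoSpec_inv_comp]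
    rfl
  let M₀ : ProjModel k K := ProjModel.ofChart (K := K) X πX hproj A j hj
  -- `A` as a subalgebra `A₀ ⊆ K`, finitely generated with `Frac A₀ = K`
  let toK : A →ₐ[k] K := IsScalarTower.toAlgHom k A K
  have htoK : Function.Injective toK := IsFractionRing.injective A K
  let A₀ : Subalgebra k K := toK.range
  have hA₀fg : A₀.FG := by
    rw [show A₀ = Subalgebra.map toK ⊤ from (Algebra.map_top toK).symm]
    exact Subalgebra.FG.map toK hft.out
  haveI hA₀fr : IsFractionRing A₀ K := by
    refine IsFractionRing.of_field A₀ K fun z => ?_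
    obtain ⟨a, b, -, rfl⟩ := IsFractionRing.div_surjective (A := A) z
    exact ⟨⟨algebraMap A K a, a, rfl⟩, ⟨algebraMap A K b, b, rfl⟩, rfl⟩
  -- `trdeg_k K = dim X = 3`
  have htr : Algebra.trdeg k K = 3 := by
    haveI : Algebra.FiniteType k A₀ := A₀.fg_iff_finiteType.mp hA₀fg
    obtain ⟨m, hm, htrm⟩ := exists_ringKrullDim_eq_and_trdeg_eq k A₀
    have e : A ≃ₐ[k] A₀ := AlgEquiv.ofInjective toK htoK
    have hdimA : ringKrullDim A = 3 := by
      have h1 := topologicalKrullDim_eq_ringKrullDim_of_isAffineOpen πX hU ⟨_, hηU⟩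
      rw [hdim] at h1
      rw [ringKrullDim_eq_of_ringEquiv U.topIso.commRingCatIsoToRingEquiv]
      exact h1.symm
    have hm3 : (m : WithBot ℕ∞) = 3 := by
      rw [← hm, ← ringKrullDim_eq_of_ringEquiv e.toRingEquiv, hdimA]
    have hm3' : m = 3 := by exact_mod_cast hm3
    rw [trdeg_eq_trdeg_of_isFractionRing A₀, htrm, hm3']
    norm_num
  -- a finite resolving system of affine models, from (LU)
  have hcov : ∀ v : ZariskiRiemannSpace k K, ∃ T : Subalgebra k K,
      (T.FG ∧ IsFractionRing T K) ∧ ZariskiRiemannSpace.HasRegularCentre T v :=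
    fun v => hLU.exists_hasRegularCentre A₀ hA₀fg (le_of_eq htr) v
  obtain ⟨𝒯, h𝒯, h𝒯cov⟩ := exists_finite_resolvingSystem' (P := fun T => IsFractionRing T K)
    (fun T hT => (isJ2Ring_of_field k).2 T ((Subalgebra.fg_iff_finiteType T).mp hT)) hcov
  -- their projective closures: a finite resolving system of projective models
  have hM : ∀ T : ↥𝒯, ∃ M : ProjModel k K, ∀ w : ZariskiRiemannSpace k K,
      ZariskiRiemannSpace.HasRegularCentre T.1 w → M.RegCentre w := fun T => by
    haveI := (h𝒯 T.1 T.2).2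
    exact ProjModel.exists_regCentre_of_hasRegularCentre T.1 (h𝒯 T.1 T.2).1
  choose M hM using hM
  let l : List (ProjModel k K) := 𝒯.attach.toList.map M
  have hlcov : ∀ v : ZariskiRiemannSpace k K, ∃ N ∈ l, N.RegCentre v := by
    intro v
    obtain ⟨T, hT, hTv⟩ := h𝒯cov v
    refine ⟨M ⟨T, hT⟩, ?_, hM ⟨T, hT⟩ v hTv⟩
    exact List.mem_map.mpr ⟨⟨T, hT⟩, Finset.mem_toList.mpr (Finset.mem_attach _ _), rfl⟩
  -- patch
  haveI : Algebra.EssFiniteType k K := inferInstance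
  exact ProjModel.hasResolution_of_resolvingSystem (hZ K htr) M₀ l hlcov

/-- **`CossartPiltant2019Patching` from the patching of two projective models.** If, over
every field `k`, for every function field `K/k` (essentially of finite type) of transcendence
degree `3` any two projective models `M₁, M₂` of `K/k` are dominated by a projective model `N`
(morphisms of models `N → Mᵢ`) with `πᵢ⁻¹(Reg Mᵢ) ⊆ Reg N` — Zariski's Fundamental (patching)
Theorem for a pair of models (Zariski 1944, p. 539), in the form of Piltant 2013, Prop. 5.1 for
the usual regularity property `P_reg` (with the normality of `N` dropped), equivalently the
patching problem displayed in Cossart–Piltant 2019, proof of Prop. 4.6, Step 3 — then surface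
resolution and local uniformization in dimension three over `k` imply weak resolution of all
reduced separated `k`-schemes of finite type of dimension `≤ 3`
(`CossartPiltant2019Patching`). The hypothesis is stated inline, and only UNDER the two
hypotheses of `CossartPiltant2019Patching` itself (surface resolution over `k` — Piltant's proof
of Prop. 5.1 invokes resolution of surface singularities, Lemma 5.3 — and (LU), Piltant's
Axiom 5), which makes it weaker than the unconditional statement
(`CossartPiltant2019Patching.of_twoModelPatching'`); it is NOT a named fact of the tree. Proof:
`ResolutionOverUpToDim.of_projective` + the dimension split +
`hasResolution_of_twoModelPatching_of_dim_three`.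
[cite: CossartPiltant2019, Prop. 4.6 (arXiv v1: Prop. 4.4), proof, Steps 1–3] -/
theorem CossartPiltant2019Patching.of_twoModelPatching
    (hZ : ∀ (k : Type u) [Field k], ResolutionOverUpToDim k 2 → LocalUniformization3 k →
      ∀ (K : Type u) [Field K] [Algebra k K] [Algebra.EssFiniteType k K],
        Algebra.trdeg k K = 3 → ∀ M₁ M₂ : ProjModel k K,
          ∃ (N : ProjModel k K) (φ₁ : N.Hom M₁) (φ₂ : N.Hom M₂), φ₁.RegLe ∧ φ₂.RegLe) :
    CossartPiltant2019Patching.{u} := by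
  intro k _ hres2 hLU
  refine ResolutionOverUpToDim.of_projective fun n X ι hι hint hdim => ?_
  haveI := hι
  haveI := hint
  rcases le_two_or_eq_three_of_le_three hdim with h2 | h3
  · haveI : IsProper (Motives.projectiveSpace n k).hom := Motives.isProper_projectiveSpace n k
    exact hres2 X (ι ≫ (Motives.projectiveSpace n k).hom) inferInstance inferInstance
      inferInstance inferInstance h2
  · exact hasResolution_of_twoModelPatching_of_dim_three (hZ k hres2 hLU) hLU X ι h3

/-- The same from the UNCONDITIONAL two-model patching statement (Piltant 2013, Prop. 5.1 for
`P = P_reg`, normality of the dominating model dropped), for every ground field and every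
function field of transcendence degree `3`.
[cite: CossartPiltant2019, Prop. 4.6 (arXiv v1: Prop. 4.4), proof, Steps 1–3] -/
theorem CossartPiltant2019Patching.of_twoModelPatching'
    (hZ : ∀ (k : Type u) [Field k] (K : Type u) [Field K] [Algebra k K]
      [Algebra.EssFiniteType k K], Algebra.trdeg k K = 3 → ∀ M₁ M₂ : ProjModel k K,
        ∃ (N : ProjModel k K) (φ₁ : N.Hom M₁) (φ₂ : N.Hom M₂), φ₁.RegLe ∧ φ₂.RegLe) :
    CossartPiltant2019Patching.{u} :=
  CossartPiltant2019Patching.of_twoModelPatching fun k _ _ _ => hZ k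

end Literature.AlgebraicGeometry.Resolution

end
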